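import Summits.QuantumFields.BalabanUV.Beta.GAN24.StaircasePairing
import Summits.QuantumFields.BalabanUV.Beta.GAN24.StaircasePairsReadings

/-!
# `BalabanUV.Beta.GAN24.StaircasePairingReadings` — binder row G-an2-4 / (CONV-C), CT-ROUTE (row owner's design `gen18/CT3-MECHANISM.md` v1.1 §(b)∕(c)),
# a SUPPLIER for step CT-3c: the owner's log-free staircase pairing bound (CT-3b2b `StaircasePairing`) for an ARBITRARY BOND READING of the gauge
# function — TIP `ψ(u+e_κ)`, BASE `ψ u`, or any `θ₀·ψ u + θ₁·ψ(u+e_κ)` with `|θ₀| + |θ₁| ≤ 1` — with the OWNER'S WEIGHTS VERBATIM, so that his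
# `sum_weights_le_of_geometric` closes it to the same END `8e^{5κ₀}·αβ·Lc^k·(2τ + Φ₀Lc^k)·Σ'E`

NOT IN PRINT; OUR PROOF ATTEMPT (G-an2-4 formalisation swarm → CRUX TEAM (2), leaf seat `b2b-balaban-gan24-formalise-leaf-03`, gen 52; journal `CLAIMS.log`
INTENT «DRESSED-PARTNER READINGS» l.31705).  [folklore] bookkeeping over `StaircasePairsReadings` ((i′)∕(ii′)) and the row owner gan24-p1-g18's
`StaircasePairing` (`sum_weights_le_of_geometric`, p272969) BY NAME; 0 cited facts, 0 `def`, 0 `def … : Prop`, 0 sorry.  HONEST FRAMING (cell contract,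
verbatim): «discharging `BetaPertH` makes Bałaban's UV stability UNCONDITIONAL — a real constructive-QFT result; it is NOT the continuum limit and NOT the
Clay problem.»  HONEST DEPENDENCY (verbatim): «continuum YM on T⁴ ⇐ BetaPertH ∧ nine spine estimates (0/9 proved); BetaPertH ⇐ (D1) ∧ (D4) ∧ CAP+tail;
G-an2-4 gates asym, D1 and NE2/3/4.»

## Why
The MIDPOINT reading `½(ψ u + ψ(u+e_κ))` is the owner's `StaircasePairing.abs_pairing_le_sum`; leaf-02's cells (`ContactOneGaugeCellTable.cell_eq'` ∕
`cellIdx_eq'`) also read the gauge function at the TIP `ψ(u+e_κ)` (the `T₁`-slot partner) and at the BASE `ψ z` (index-slot cell), and leaf-01's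
`ContactKernelCells.contact_legChain_ff_eq_cells` puts a DRESSED partner `T = B + dzΨ′` in the tip slot of two of its three cells.  The dressed partner's
`dzΨ′` against `ψ_reading·d*dB` (`d*dT = d*dB = 𝒬ᵀφ`) is the pairing below.

## Contents (generic `d`; the owner's binders and weights verbatim)
* §1 `summandReading_eq_sum_sum` — the `θ`-read pairing summand of two finite staircase sums is the double sum of the piece pairings.
* §2 **`abs_pairingReading_le_sum`** — `|Σ'_u t κ u·(θ₀ψ u + θ₁ψ(u+e_κ))·(χ(u+e_κ) − χ u)| ≤ [Σ_{s₁,s₂≤k} w s₁ s₂]·Σ'E`, `w` = the owner's weight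
  (`2e^{2κ₀}τ·a s₁ b s₂·(Lc^{s₂})⁻¹` if `s₁ ≤ s₂` by (i′), `2e^{5κ₀}(Φ₀ + τ(Lc^{s₁})⁻¹)·a s₁ b s₂` else by (ii′)).
* §3 ENDs for geometric letters (`a s ≤ αLc^s`, `b s ≤ βLc^s`, `2 ≤ Lc`) via the owner's `sum_weights_le_of_geometric`:
  **`abs_pairingReading_le_of_geometric`** (any `θ`), **`abs_pairingTip_le_of_geometric`** (`ψ(u+e_κ)`), **`abs_pairingBase_le_of_geometric`** (`ψ u`):
  `≤ 8e^{5κ₀}·αβ·Lc^k·(2τ + Φ₀Lc^k)·Σ'E`.  (The midpoint END is the owner's — not restated.)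
Discharges NO slot letter; asserts NO shape of Bałaban's stencils; 0 wall binders; NEVER «G-an2-4 closed»; NOT D1, NOT BetaPertH, NOT continuum, NOT Clay.
-/

noncomputable section

open Finset
open scoped BigOperators
open Literature.MathematicalPhysics.QuantumFieldTheory
open Literature.MathematicalPhysics.QuantumFieldTheory.LatticeForm (quo)
open Literature.MathematicalPhysics.QuantumFieldTheory.Balaban1983to89
open Literature.MathematicalPhysics.QuantumFieldTheory.Balaban1983to89.Beta
open B4ContourShift (supNorm supNorm_nonneg)
open AffineAveraging (Form0 Form1 Site unitVec)
open AffineReproduction (contourSumAdj)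
open AveragingContours (blk)
open Summit.QuantumFields.BalabanUV.Beta.GAN24.StaircasePairsReadings (abs_reading_le abs_pair_le_of_weight_diff abs_pair_le_of_reading_blockConst)
open Summit.QuantumFields.BalabanUV.Beta.GAN24.StaircasePairing (sum_weights_le_of_geometric)

namespace Summit.QuantumFields.BalabanUV.Beta.GAN24.StaircasePairingReadings

variable {d : ℕ}

/-! ## §1 The `θ`-read pairing splits over the scale pairs -/

/-- [folklore] Pointwise: the `θ`-read pairing summand of two finite sums of pieces is the double sum of the piece pairings. -/
theorem summandReading_eq_sum_sum {k : ℕ} (t : Form1 (d + 1) ℝ) (θ₀ θ₁ : ℝ) (lams mus : ℕ → Form0 (d + 1) ℝ) (κ : Fin (d + 1)) (u : Site (d + 1)) :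
    t κ u * (θ₀ * ∑ s ∈ Finset.range (k + 1), lams s u + θ₁ * ∑ s ∈ Finset.range (k + 1), lams s (u + unitVec κ))
        * (∑ s ∈ Finset.range (k + 1), mus s (u + unitVec κ) - ∑ s ∈ Finset.range (k + 1), mus s u)
      = ∑ s₁ ∈ Finset.range (k + 1), ∑ s₂ ∈ Finset.range (k + 1),
          t κ u * (θ₀ * lams s₁ u + θ₁ * lams s₁ (u + unitVec κ)) * (mus s₂ (u + unitVec κ) - mus s₂ u) := by
  rw [Finset.mul_sum, Finset.mul_sum, ← Finset.sum_add_distrib, ← Finset.sum_sub_distrib, Finset.mul_sum]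
  simp_rw [Finset.mul_sum, Finset.sum_mul]
  rw [Finset.sum_comm]

/-! ## §2 The bound with the owner's weights -/

section Main

variable {N Lc k : ℕ} [NeZero N] {κ₀ τ Φ₀ : ℝ} {y₀ c₁ c₂ : Site (d + 1)} {φ : Form1 (d + 1) ℝ} {G₁ G₂ : ℕ → Form0 (d + 1) ℝ} {a b : ℕ → ℝ}

/-- NOT IN PRINT; OUR PROOF ATTEMPT (CT3-MECHANISM v1.1 §(b) for an arbitrary bond reading; [folklore] bookkeeping; the owner's `abs_pairing_le_sum`
proof with (i)∕(ii) replaced by (i′)∕(ii′) of `StaircasePairsReadings`).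
**THE `θ`-READ PAIRING OF TWO STAIRCASE SUMS AGAINST THE TENT FORCE, SCALE PAIR BY SCALE PAIR, DERIVATIVE ON THE COARSER PIECE**: with `t = 𝒬ᵀ_N φ`,
`|φ κ y| ≤ Φ₀e^{−κ₀‖y−y₀‖∞}`, `|t κ u| ≤ τE₀ u`, pieces `|G₁ s (blk (Lc^s) u)| ≤ a s·E₁ u`, `|G₂ s (blk (Lc^s) u)| ≤ b s·E₂ u` (`s ≤ k`), `Lc^s ∣ N` (`s ≤ k`),
`1 ≤ Lc`, `|θ₀| + |θ₁| ≤ 1`, `E = E₀E₁E₂` summable: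
`|Σ'_u t κ u·(θ₀·ψ u + θ₁·ψ(u+e_κ))·(χ(u+e_κ) − χ u)| ≤ (Σ_{s₁ ≤ k} Σ_{s₂ ≤ k} w s₁ s₂)·Σ'E` with the OWNER's weights
`w s₁ s₂ = if s₁ ≤ s₂ then 2e^{2κ₀}·τ·a s₁·b s₂·(Lc^{s₂})⁻¹ else 2e^{5κ₀}·(Φ₀ + τ·(Lc^{s₁})⁻¹)·a s₁·b s₂`. -/
theorem abs_pairingReading_le_sum (hκ : 0 ≤ κ₀) (hτ : 0 ≤ τ) (hΦ : 0 ≤ Φ₀) (hLc : 1 ≤ Lc) (ha : ∀ s, 0 ≤ a s) (hb : ∀ s, 0 ≤ b s)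
    {θ₀ θ₁ : ℝ} (hθ : |θ₀| + |θ₁| ≤ 1) (hdvd : ∀ s, s ≤ k → Lc ^ s ∣ N)
    (hφ : ∀ κ y, |φ κ y| ≤ Φ₀ * Real.exp (-(κ₀ * supNorm (y - y₀))))
    (ht : ∀ κ u, |contourSumAdj N φ κ u| ≤ τ * Real.exp (-(κ₀ * supNorm (quo N u - y₀))))
    (hG₁ : ∀ s, s ≤ k → ∀ u, |G₁ s (blk (Lc ^ s) u)| ≤ a s * Real.exp (-(κ₀ * supNorm (quo N u - c₁))))
    (hG₂ : ∀ s, s ≤ k → ∀ u, |G₂ s (blk (Lc ^ s) u)| ≤ b s * Real.exp (-(κ₀ * supNorm (quo N u - c₂))))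
    (hE : Summable fun u : Site (d + 1) => Real.exp (-(κ₀ * supNorm (quo N u - y₀))) * Real.exp (-(κ₀ * supNorm (quo N u - c₁))) *
      Real.exp (-(κ₀ * supNorm (quo N u - c₂))))
    {ψ χ : Form0 (d + 1) ℝ} (hψ : ∀ u, ψ u = ∑ s ∈ Finset.range (k + 1), G₁ s (blk (Lc ^ s) u))
    (hχ : ∀ u, χ u = ∑ s ∈ Finset.range (k + 1), G₂ s (blk (Lc ^ s) u)) (κ : Fin (d + 1)) :
    |∑' u, contourSumAdj N φ κ u * (θ₀ * ψ u + θ₁ * ψ (u + unitVec κ)) * (χ (u + unitVec κ) - χ u)|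
      ≤ (∑ s₁ ∈ Finset.range (k + 1), ∑ s₂ ∈ Finset.range (k + 1),
          (if s₁ ≤ s₂ then 2 * Real.exp (2 * κ₀) * τ * a s₁ * b s₂ * (((Lc : ℝ) ^ s₂))⁻¹
           else 2 * Real.exp (5 * κ₀) * (Φ₀ + τ * (((Lc : ℝ) ^ s₁))⁻¹) * a s₁ * b s₂)) *
        ∑' u : Site (d + 1), Real.exp (-(κ₀ * supNorm (quo N u - y₀))) * Real.exp (-(κ₀ * supNorm (quo N u - c₁))) *
          Real.exp (-(κ₀ * supNorm (quo N u - c₂))) := by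
  set S : ℝ := ∑' u : Site (d + 1), Real.exp (-(κ₀ * supNorm (quo N u - y₀))) * Real.exp (-(κ₀ * supNorm (quo N u - c₁))) *
          Real.exp (-(κ₀ * supNorm (quo N u - c₂))) with hS
  set t := contourSumAdj N φ with htdef
  -- the piece pairings
  set F : ℕ → ℕ → Site (d + 1) → ℝ := fun s₁ s₂ u =>
    t κ u * (θ₀ * G₁ s₁ (blk (Lc ^ s₁) u) + θ₁ * G₁ s₁ (blk (Lc ^ s₁) (u + unitVec κ)))
      * (G₂ s₂ (blk (Lc ^ s₂) (u + unitVec κ)) - G₂ s₂ (blk (Lc ^ s₂) u)) with hF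
  have hP : ∀ s, 1 ≤ Lc ^ s := fun s => Nat.one_le_pow _ _ (by omega)
  -- per pair: summable, and bounded by the weight times `S`
  have hpair : ∀ s₁ ∈ Finset.range (k + 1), ∀ s₂ ∈ Finset.range (k + 1),
      Summable (F s₁ s₂) ∧ |∑' u, F s₁ s₂ u| ≤
        (if s₁ ≤ s₂ then 2 * Real.exp (2 * κ₀) * τ * a s₁ * b s₂ * (((Lc : ℝ) ^ s₂))⁻¹
         else 2 * Real.exp (5 * κ₀) * (Φ₀ + τ * (((Lc : ℝ) ^ s₁))⁻¹) * a s₁ * b s₂) * S := by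
    intro s₁ hs₁ s₂ hs₂
    have hk₁ : s₁ ≤ k := Nat.lt_succ_iff.1 (Finset.mem_range.1 hs₁)
    have hk₂ : s₂ ≤ k := Nat.lt_succ_iff.1 (Finset.mem_range.1 hs₂)
    by_cases hle : s₁ ≤ s₂
    · -- the χ-piece (differentiated) is the coarser one: (i′) with the θ-read ψ-piece as the bond weight
      rw [if_pos hle]
      have hΛ : ∀ κ' u, |(fun κ' u => θ₀ * G₁ s₁ (blk (Lc ^ s₁) u) + θ₁ * G₁ s₁ (blk (Lc ^ s₁) (u + unitVec κ'))) κ' u|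
          ≤ a s₁ * Real.exp κ₀ * Real.exp (-(κ₀ * supNorm (quo N u - c₁))) := fun κ' u =>
        abs_reading_le (N := N) (lam := fun u => G₁ s₁ (blk (Lc ^ s₁) u)) hκ (ha s₁) hθ (hG₁ s₁ hk₁) κ' u
      have h := abs_pair_le_of_weight_diff (N := N) (y₀ := y₀) (c₁ := c₁) (c₂ := c₂) hκ hτ (ha s₁) (hb s₂) (hP s₂) (hdvd s₂ hk₂)
        (t := t) (Λ := fun κ' u => θ₀ * G₁ s₁ (blk (Lc ^ s₁) u) + θ₁ * G₁ s₁ (blk (Lc ^ s₁) (u + unitVec κ'))) (g := G₂ s₂) ht hΛ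
        (hG₂ s₂ hk₂) hE κ
      refine ⟨h.1, h.2.trans (le_of_eq ?_)⟩
      push_cast; ring
    · -- the ψ-piece (θ-read) is the coarser one: (ii′), by parts
      rw [if_neg hle]
      have h := abs_pair_le_of_reading_blockConst (N := N) (y₀ := y₀) (c₁ := c₁) (c₂ := c₂) hκ hτ hΦ (ha s₁) (hb s₂) (hP s₁) (hdvd s₁ hk₁)
        hθ (φ := φ) (g := G₁ s₁) (m := fun u => G₂ s₂ (blk (Lc ^ s₂) u)) hφ ht (hG₁ s₁ hk₁) (hG₂ s₂ hk₂) hE κ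
      refine ⟨h.1, h.2.trans (le_of_eq ?_)⟩
      push_cast; ring
  -- the pairing is the double sum of the piece pairings
  have hsummand : ∀ u, t κ u * (θ₀ * ψ u + θ₁ * ψ (u + unitVec κ)) * (χ (u + unitVec κ) - χ u)
      = ∑ s₁ ∈ Finset.range (k + 1), ∑ s₂ ∈ Finset.range (k + 1), F s₁ s₂ u := by
    intro u
    rw [hψ u, hψ (u + unitVec κ), hχ u, hχ (u + unitVec κ)]
    exact summandReading_eq_sum_sum t θ₀ θ₁ (fun s u => G₁ s (blk (Lc ^ s) u)) (fun s u => G₂ s (blk (Lc ^ s) u)) κ u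
  have hinner : ∀ s₁ ∈ Finset.range (k + 1), Summable fun u => ∑ s₂ ∈ Finset.range (k + 1), F s₁ s₂ u :=
    fun s₁ hs₁ => summable_sum fun s₂ hs₂ => (hpair s₁ hs₁ s₂ hs₂).1
  rw [tsum_congr hsummand, Summable.tsum_finsetSum hinner]
  rw [Finset.sum_congr rfl fun s₁ hs₁ => Summable.tsum_finsetSum fun s₂ hs₂ => (hpair s₁ hs₁ s₂ hs₂).1, Finset.sum_mul]
  refine (Finset.abs_sum_le_sum_abs _ _).trans (Finset.sum_le_sum fun s₁ hs₁ => ?_)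
  rw [Finset.sum_mul]
  exact (Finset.abs_sum_le_sum_abs _ _).trans (Finset.sum_le_sum fun s₂ hs₂ => (hpair s₁ hs₁ s₂ hs₂).2)

/-! ## §3 The ENDs for geometric letters: the owner's `sum_weights_le_of_geometric` BY NAME -/

/-- NOT IN PRINT; OUR PROOF ATTEMPT ([folklore] composition of §2 with the owner's `StaircasePairing.sum_weights_le_of_geometric`).
**THE `θ`-READ PAIRING FOR GEOMETRIC PER-SCALE LETTERS** (`2 ≤ Lc`, `a s ≤ α·Lc^s`, `b s ≤ β·Lc^s`, all letters `≥ 0`, `|θ₀| + |θ₁| ≤ 1`):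
`|Σ'_u t κ u·(θ₀·ψ u + θ₁·ψ(u+e_κ))·(χ(u+e_κ) − χ u)| ≤ 8e^{5κ₀}·α·β·Lc^k·(2τ + Φ₀·Lc^k)·Σ'E` — LINEAR in the top scale, no `log N`. -/
theorem abs_pairingReading_le_of_geometric (hκ : 0 ≤ κ₀) (hτ : 0 ≤ τ) (hΦ : 0 ≤ Φ₀) (hLc : 2 ≤ Lc) {α β : ℝ} (hα : 0 ≤ α) (hβ : 0 ≤ β)
    (ha : ∀ s, 0 ≤ a s) (hb : ∀ s, 0 ≤ b s) (haL : ∀ s, a s ≤ α * (Lc : ℝ) ^ s) (hbL : ∀ s, b s ≤ β * (Lc : ℝ) ^ s)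
    {θ₀ θ₁ : ℝ} (hθ : |θ₀| + |θ₁| ≤ 1) (hdvd : ∀ s, s ≤ k → Lc ^ s ∣ N)
    (hφ : ∀ κ y, |φ κ y| ≤ Φ₀ * Real.exp (-(κ₀ * supNorm (y - y₀))))
    (ht : ∀ κ u, |contourSumAdj N φ κ u| ≤ τ * Real.exp (-(κ₀ * supNorm (quo N u - y₀))))
    (hG₁ : ∀ s, s ≤ k → ∀ u, |G₁ s (blk (Lc ^ s) u)| ≤ a s * Real.exp (-(κ₀ * supNorm (quo N u - c₁))))
    (hG₂ : ∀ s, s ≤ k → ∀ u, |G₂ s (blk (Lc ^ s) u)| ≤ b s * Real.exp (-(κ₀ * supNorm (quo N u - c₂))))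
    (hE : Summable fun u : Site (d + 1) => Real.exp (-(κ₀ * supNorm (quo N u - y₀))) * Real.exp (-(κ₀ * supNorm (quo N u - c₁))) *
      Real.exp (-(κ₀ * supNorm (quo N u - c₂))))
    {ψ χ : Form0 (d + 1) ℝ} (hψ : ∀ u, ψ u = ∑ s ∈ Finset.range (k + 1), G₁ s (blk (Lc ^ s) u))
    (hχ : ∀ u, χ u = ∑ s ∈ Finset.range (k + 1), G₂ s (blk (Lc ^ s) u)) (κ : Fin (d + 1)) :
    |∑' u, contourSumAdj N φ κ u * (θ₀ * ψ u + θ₁ * ψ (u + unitVec κ)) * (χ (u + unitVec κ) - χ u)|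
      ≤ (8 * Real.exp (5 * κ₀) * α * β * (Lc : ℝ) ^ k * (2 * τ + Φ₀ * (Lc : ℝ) ^ k)) *
        ∑' u : Site (d + 1), Real.exp (-(κ₀ * supNorm (quo N u - y₀))) * Real.exp (-(κ₀ * supNorm (quo N u - c₁))) *
          Real.exp (-(κ₀ * supNorm (quo N u - c₂))) := by
  refine (abs_pairingReading_le_sum hκ hτ hΦ (by omega) ha hb hθ hdvd hφ ht hG₁ hG₂ hE hψ hχ κ).trans ?_
  exact mul_le_mul_of_nonneg_right (sum_weights_le_of_geometric hLc hκ hτ hΦ hα hβ ha hb haL hbL)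
    (tsum_nonneg fun u => by positivity)

/-- NOT IN PRINT; OUR PROOF ATTEMPT ([folklore]; `θ = (0, 1)` in `abs_pairingReading_le_of_geometric`).
**THE TIP-READ PAIRING** — the gauge function read at the bond's tip `ψ(u+e_κ)` (leaf-02's `cell_eq'`, the `T₁`-slot partner):
`|Σ'_u t κ u·ψ(u+e_κ)·(χ(u+e_κ) − χ u)| ≤ 8e^{5κ₀}·α·β·Lc^k·(2τ + Φ₀·Lc^k)·Σ'E`. -/
theorem abs_pairingTip_le_of_geometric (hκ : 0 ≤ κ₀) (hτ : 0 ≤ τ) (hΦ : 0 ≤ Φ₀) (hLc : 2 ≤ Lc) {α β : ℝ} (hα : 0 ≤ α) (hβ : 0 ≤ β)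
    (ha : ∀ s, 0 ≤ a s) (hb : ∀ s, 0 ≤ b s) (haL : ∀ s, a s ≤ α * (Lc : ℝ) ^ s) (hbL : ∀ s, b s ≤ β * (Lc : ℝ) ^ s)
    (hdvd : ∀ s, s ≤ k → Lc ^ s ∣ N)
    (hφ : ∀ κ y, |φ κ y| ≤ Φ₀ * Real.exp (-(κ₀ * supNorm (y - y₀))))
    (ht : ∀ κ u, |contourSumAdj N φ κ u| ≤ τ * Real.exp (-(κ₀ * supNorm (quo N u - y₀))))
    (hG₁ : ∀ s, s ≤ k → ∀ u, |G₁ s (blk (Lc ^ s) u)| ≤ a s * Real.exp (-(κ₀ * supNorm (quo N u - c₁))))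
    (hG₂ : ∀ s, s ≤ k → ∀ u, |G₂ s (blk (Lc ^ s) u)| ≤ b s * Real.exp (-(κ₀ * supNorm (quo N u - c₂))))
    (hE : Summable fun u : Site (d + 1) => Real.exp (-(κ₀ * supNorm (quo N u - y₀))) * Real.exp (-(κ₀ * supNorm (quo N u - c₁))) *
      Real.exp (-(κ₀ * supNorm (quo N u - c₂))))
    {ψ χ : Form0 (d + 1) ℝ} (hψ : ∀ u, ψ u = ∑ s ∈ Finset.range (k + 1), G₁ s (blk (Lc ^ s) u))
    (hχ : ∀ u, χ u = ∑ s ∈ Finset.range (k + 1), G₂ s (blk (Lc ^ s) u)) (κ : Fin (d + 1)) :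
    |∑' u, contourSumAdj N φ κ u * ψ (u + unitVec κ) * (χ (u + unitVec κ) - χ u)|
      ≤ (8 * Real.exp (5 * κ₀) * α * β * (Lc : ℝ) ^ k * (2 * τ + Φ₀ * (Lc : ℝ) ^ k)) *
        ∑' u : Site (d + 1), Real.exp (-(κ₀ * supNorm (quo N u - y₀))) * Real.exp (-(κ₀ * supNorm (quo N u - c₁))) *
          Real.exp (-(κ₀ * supNorm (quo N u - c₂))) := by
  have hθ : |(0 : ℝ)| + |(1 : ℝ)| ≤ 1 := by norm_num
  have h := abs_pairingReading_le_of_geometric hκ hτ hΦ hLc hα hβ ha hb haL hbL hθ hdvd hφ ht hG₁ hG₂ hE hψ hχ κ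
  have e : (fun u => contourSumAdj N φ κ u * (0 * ψ u + 1 * ψ (u + unitVec κ)) * (χ (u + unitVec κ) - χ u))
      = fun u => contourSumAdj N φ κ u * ψ (u + unitVec κ) * (χ (u + unitVec κ) - χ u) := by
    funext u; ring
  rwa [e] at h

/-- NOT IN PRINT; OUR PROOF ATTEMPT ([folklore]; `θ = (1, 0)` in `abs_pairingReading_le_of_geometric`).
**THE BASE-READ PAIRING** — the gauge function read at the bond's base `ψ u` (leaf-02's `cellIdx_eq'`, the index-slot cell):
`|Σ'_u t κ u·ψ u·(χ(u+e_κ) − χ u)| ≤ 8e^{5κ₀}·α·β·Lc^k·(2τ + Φ₀·Lc^k)·Σ'E`. -/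
theorem abs_pairingBase_le_of_geometric (hκ : 0 ≤ κ₀) (hτ : 0 ≤ τ) (hΦ : 0 ≤ Φ₀) (hLc : 2 ≤ Lc) {α β : ℝ} (hα : 0 ≤ α) (hβ : 0 ≤ β)
    (ha : ∀ s, 0 ≤ a s) (hb : ∀ s, 0 ≤ b s) (haL : ∀ s, a s ≤ α * (Lc : ℝ) ^ s) (hbL : ∀ s, b s ≤ β * (Lc : ℝ) ^ s)
    (hdvd : ∀ s, s ≤ k → Lc ^ s ∣ N)
    (hφ : ∀ κ y, |φ κ y| ≤ Φ₀ * Real.exp (-(κ₀ * supNorm (y - y₀))))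
    (ht : ∀ κ u, |contourSumAdj N φ κ u| ≤ τ * Real.exp (-(κ₀ * supNorm (quo N u - y₀))))
    (hG₁ : ∀ s, s ≤ k → ∀ u, |G₁ s (blk (Lc ^ s) u)| ≤ a s * Real.exp (-(κ₀ * supNorm (quo N u - c₁))))
    (hG₂ : ∀ s, s ≤ k → ∀ u, |G₂ s (blk (Lc ^ s) u)| ≤ b s * Real.exp (-(κ₀ * supNorm (quo N u - c₂))))
    (hE : Summable fun u : Site (d + 1) => Real.exp (-(κ₀ * supNorm (quo N u - y₀))) * Real.exp (-(κ₀ * supNorm (quo N u - c₁))) *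
      Real.exp (-(κ₀ * supNorm (quo N u - c₂))))
    {ψ χ : Form0 (d + 1) ℝ} (hψ : ∀ u, ψ u = ∑ s ∈ Finset.range (k + 1), G₁ s (blk (Lc ^ s) u))
    (hχ : ∀ u, χ u = ∑ s ∈ Finset.range (k + 1), G₂ s (blk (Lc ^ s) u)) (κ : Fin (d + 1)) :
    |∑' u, contourSumAdj N φ κ u * ψ u * (χ (u + unitVec κ) - χ u)|
      ≤ (8 * Real.exp (5 * κ₀) * α * β * (Lc : ℝ) ^ k * (2 * τ + Φ₀ * (Lc : ℝ) ^ k)) *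
        ∑' u : Site (d + 1), Real.exp (-(κ₀ * supNorm (quo N u - y₀))) * Real.exp (-(κ₀ * supNorm (quo N u - c₁))) *
          Real.exp (-(κ₀ * supNorm (quo N u - c₂))) := by
  have hθ : |(1 : ℝ)| + |(0 : ℝ)| ≤ 1 := by norm_num
  have h := abs_pairingReading_le_of_geometric hκ hτ hΦ hLc hα hβ ha hb haL hbL hθ hdvd hφ ht hG₁ hG₂ hE hψ hχ κ
  have e : (fun u => contourSumAdj N φ κ u * (1 * ψ u + 0 * ψ (u + unitVec κ)) * (χ (u + unitVec κ) - χ u))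
      = fun u => contourSumAdj N φ κ u * ψ u * (χ (u + unitVec κ) - χ u) := by
    funext u; ring
  rwa [e] at h

end Main

end Summit.QuantumFields.BalabanUV.Beta.GAN24.StaircasePairingReadings

end
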